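import Mathlib
import Summits.NavierStokesRegularity.NavierStokesRegularity.Theorems.HeteroclinicTriggerChainTriggerChainFrontStepConnectionForm
import HarnessLib

/-!
# `HeteroclinicTriggerChain` — crux `TriggerChainFrontStep` (item stmt-NavierStokesRegularity-22785):
  analytic consequences of the (connection) clause, II — the JUNK-FREE CRITERION

Setting of `…ConnectionForm` (an exact complete-transfer connection `H` of a four-mode table in normal
form at the pure-mode saddle, with the (parity) clause). The crux's hypotheses allow the connection to
make a JUNK EXCURSION (nonzero amplitudes in the modes `j ∉ {i₀,i₁}` at shell `0`, routed
`u² → X_j → y`), and then the transfer rate `g` is strictly below the trigger rate `e`. This file proves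
the criterion that rules excursions out:

* `htcCF_junkFree_of_noSelfInteraction` — if the trigger's self-interaction feeds no junk mode
  (`α i₁ i₁ j (0,0,0) = 0` for `j ∉ {i₀,i₁}`), then `H j 0 ≡ 0` for every junk mode `j`.

Proof: the junk energy `J = ∑_{junk} X_j²` equals `1 - x² - u² - y²` (two-shell energy `≡ 1`) and obeys
`J' = 2x·∑_{junk} d_j(0)X_j² - 2y·∑_{junk} g_j X_j²` with `d_j(0) ≤ 0 ≤ g_j`, `0 ≤ y`; while the carrier
`x` is nonnegative (near `-∞`) `J` is nonincreasing and tends to `0`, hence vanishes; afterwards the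
Grönwall comparison `J' ≤ C·J` (`|x| ≤ 1`, `C = 2∑|d_j(0)|`) keeps it zero. The converse direction and the
consequences (`g = e`, logistic arc, seed coefficient) are in `…ConnectionArc`.

HONEST FRAMING: elementary ODE facts about five real functions driven by a Tao-type MODEL lattice table
(Tao 2016 §4); helper for the crux, no stub credit; nothing here is a statement about the Navier–Stokes
equations; no summit, rung or crux is proved by this file.
-/

noncomputable section

set_option linter.dupNamespace false

namespace Summit.NavierStokesRegularity.NavierStokesRegularity.Theorems

open Filter Topology Set Literature.Analysis.FluidPDE Literature.Analysis.FluidPDE.TaoCascade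

/-- Splitting a sum over the four modes into the carrier, the trigger and the junk modes. [folklore] -/
theorem htcCF_sum_split (f : Fin 4 → ℝ) {i₀ i₁ : Fin 4} (hne : i₀ ≠ i₁) :
    ∑ j, f j = f i₀ + f i₁ + ∑ j, (if j = i₀ ∨ j = i₁ then 0 else f j) := by
  have h : ∀ j : Fin 4, f j = (if j = i₀ then f j else 0) + (if j = i₁ then f j else 0) +
      (if j = i₀ ∨ j = i₁ then 0 else f j) := by
    intro j
    by_cases h0 : j = i₀
    · subst h0; simp [hne]
    · by_cases h1 : j = i₁
      · subst h1; simp [h0]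
      · simp [h0, h1]
  rw [Finset.sum_congr rfl fun j _ => h j, Finset.sum_add_distrib, Finset.sum_add_distrib,
    Finset.sum_ite_eq', Finset.sum_ite_eq']
  simp

/-- **JUNK-FREE CRITERION.** If the trigger's self-interaction feeds no junk mode
(`α i₁ i₁ j (0,0,0) = 0` for `j ∉ {i₀,i₁}`), then the connection charges no junk mode: `H j 0 ≡ 0` for
`j ∉ {i₀,i₁}`. The junk energy `J = ∑_{junk} X_j²` satisfies `J' = 2x·∑_{junk} d_j(0)X_j² - 2y·∑_{junk}
g_j X_j²` with `d_j(0) ≤ 0 ≤ g_j` and `0 ≤ y`; while the carrier is nonnegative (near `-∞`) `J` is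
nonincreasing and tends to `0`, so vanishes; afterwards `J' ≤ C·J` (`|x| ≤ 1`) keeps it zero. [this file] -/
theorem htcCF_junkFree_of_noSelfInteraction (α : Fin 4 → Fin 4 → Fin 4 → ℤ × ℤ × ℤ → ℝ)
    (i₀ i₁ : Fin 4) (d : Fin 4 → ℤ → ℝ) (hne : i₀ ≠ i₁)
    (hsym : IsSymmetricCoeff α) (hcanc : IsCancellingCoeff α)
    (hpure : ∀ X : Fin 4 → ℤ → ℝ → ℝ, (∀ i n t, i ≠ i₀ → X i n t = 0) →
      ∀ i n t, quadTerm 1 α X i n t = 0)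
    (hpar : ∀ (j₁ j₂ j₃ : Fin 4) (μ : ℤ × ℤ × ℤ), Xor (Xor (j₁ = i₁) (j₂ = i₁)) (j₃ = i₁) →
      α j₁ j₂ j₃ μ = 0)
    (hsad : ∀ (Y : Fin 4 → ℤ → ℝ → ℝ) (i : Fin 4) (n : ℤ) (t : ℝ),
      quadTerm 1 α (fun j m s => (fun j m (_ : ℝ) => if j = i₀ ∧ m = 0 then (1 : ℝ) else 0) j m s +
          Y j m s) i n t -
        quadTerm 1 α (fun j m (_ : ℝ) => if j = i₀ ∧ m = 0 then (1 : ℝ) else 0) i n t -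
        quadTerm 1 α Y i n t = d i n * Y i n t)
    (hdle : ∀ (i : Fin 4) (n : ℤ), ¬(i = i₁ ∧ n = 0) → d i n ≤ 0)
    (hb : ∀ j : Fin 4, j ≠ i₀ → j ≠ i₁ → α i₁ i₁ j (0, 0, 0) = 0)
    (H : Fin 4 → ℤ → ℝ → ℝ)
    (hH : ∀ i n t, HasDerivAt (H i n) (quadTerm 1 α H i n t) t)
    (hneg : ∀ i n t, n < 0 → H i n t = 0) (hone : ∀ i n t, 1 ≤ n → i ≠ i₀ → H i n t = 0)
    (htwo : ∀ i n t, 2 ≤ n → H i n t = 0)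
    (hbot : ∀ i n, Tendsto (H i n) atBot (𝓝 (if i = i₀ ∧ n = 0 then (1 : ℝ) else 0)))
    (htop : ∀ i n, Tendsto (H i n) atTop (𝓝 (if i = i₀ ∧ n = 1 then (1 : ℝ) else 0))) :
    ∀ (j : Fin 4) (t : ℝ), j ≠ i₀ → j ≠ i₁ → H j 0 t = 0 := by
  obtain ⟨nf1, -, -, -, -, -, nf7, -, -⟩ :=
    HeteroclinicTriggerChain.stub_normal_form α i₀ d hsym hcanc hpure hsad
  have hg : ∀ j, 0 ≤ α j j i₀ (0, 0, 1) := htcCF_pump_nonneg α i₀ i₁ d hsym hcanc hpure hsad hdle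
  obtain ⟨hy, -, hy01⟩ := htcCF_receiver_monotone α i₀ i₁ d hsym hcanc hpure hsad hdle H hH hneg
    hone htwo hbot htop
  have hE := htcCF_energy_eq_one α i₀ hcanc (fun i => nf1 i (0, 0, 0) (by decide)) H hH hneg hone
    htwo hbot
  -- the junk energy and the junk drain/pump sums
  set J : ℝ → ℝ := fun s => ∑ j, (if j = i₀ ∨ j = i₁ then 0 else H j 0 s ^ 2) with hJ
  set D : ℝ → ℝ := fun s => ∑ j, (if j = i₀ ∨ j = i₁ then 0 else d j 0 * H j 0 s ^ 2) with hD
  set G : ℝ → ℝ := fun s => ∑ j, (if j = i₀ ∨ j = i₁ then 0 else α j j i₀ (0, 0, 1) * H j 0 s ^ 2)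
    with hG
  set C : ℝ := 2 * ∑ j, |d j 0| with hC
  have hJnn : ∀ s, 0 ≤ J s := fun s =>
    Finset.sum_nonneg fun j _ => by split_ifs <;> positivity
  have hterm_le : ∀ s (j : Fin 4), j ≠ i₀ → j ≠ i₁ → H j 0 s ^ 2 ≤ J s := by
    intro s j hj0 hj1
    have h := Finset.single_le_sum (f := fun j => if j = i₀ ∨ j = i₁ then 0 else H j 0 s ^ 2)
      (fun j _ => by split_ifs <;> positivity) (Finset.mem_univ j)
    simpa [hj0, hj1] using h
  have hDnp : ∀ s, D s ≤ 0 := fun s =>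
    Finset.sum_nonpos fun j _ => by
      split_ifs with h
      · exact le_rfl
      · push Not at h
        exact mul_nonpos_of_nonpos_of_nonneg (hdle j 0 (fun h' => h.2 h'.1)) (sq_nonneg _)
  have hGnn : ∀ s, 0 ≤ G s := fun s =>
    Finset.sum_nonneg fun j _ => by
      split_ifs
      · exact le_rfl
      · exact mul_nonneg (hg j) (sq_nonneg _)
  have hDbd : ∀ s, -D s ≤ (∑ j, |d j 0|) * J s := by
    intro s
    rw [hD, hJ, Finset.mul_sum, ← Finset.sum_neg_distrib]
    refine Finset.sum_le_sum fun j _ => ?_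
    split_ifs with h
    · simp
    · have h1 : -(d j 0) ≤ |d j 0| := neg_le_abs _
      have h2 : |d j 0| ≤ ∑ k, |d k 0| :=
        Finset.single_le_sum (f := fun k => |d k 0|) (fun k _ => abs_nonneg _) (Finset.mem_univ j)
      nlinarith [sq_nonneg (H j 0 s)]
  -- energy bookkeeping: J = 1 - x² - u² - y²
  have hJeq : ∀ s, J s = 1 - H i₀ 0 s ^ 2 - H i₁ 0 s ^ 2 - H i₀ 1 s ^ 2 := by
    intro s
    obtain ⟨-, hX1⟩ := htcCF_support hneg hone htwo s
    have h0 := htcCF_sum_split (fun j => H j 0 s ^ 2) hne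
    have h1 : ∑ i, H i 1 s ^ 2 = H i₀ 1 s ^ 2 := by
      rw [Finset.sum_eq_single i₀ (fun i _ hi => by rw [hX1 i hi]; ring) (by simp)]
    have h2 := hE s
    rw [h0, h1] at h2
    simp only [hJ]
    linarith
  have hxle : ∀ s, |H i₀ 0 s| ≤ 1 := by
    intro s
    have h := hJeq s
    have h1 := hJnn s
    rw [← sq_le_one_iff_abs_le_one]
    nlinarith [sq_nonneg (H i₁ 0 s), sq_nonneg (H i₀ 1 s)]
  -- the junk sums inside the full drain/pump sums
  have hsumd : ∀ s, ∑ j, d j 0 * H j 0 s ^ 2 = d i₁ 0 * H i₁ 0 s ^ 2 + D s := by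
    intro s
    rw [htcCF_sum_split (fun j => d j 0 * H j 0 s ^ 2) hne, nf7 0]
    simp only [hD]
    ring
  have hsumg : ∀ s, ∑ j, α j j i₀ (0, 0, 1) * H j 0 s ^ 2 = α i₁ i₁ i₀ (0, 0, 1) * H i₁ 0 s ^ 2 + G s := by
    intro s
    rw [htcCF_sum_split (fun j => α j j i₀ (0, 0, 1) * H j 0 s ^ 2) hne, nf1 i₀ (0, 0, 1) (by decide)]
    simp only [hG]
    ring
  -- the derivative of J
  have hJ' : ∀ s, HasDerivAt J (2 * H i₀ 0 s * D s - 2 * H i₀ 1 s * G s) s := by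
    intro s
    obtain ⟨hX, hX1⟩ := htcCF_support hneg hone htwo s
    have hx := hH i₀ 0 s
    rw [htcCA_quadTerm_carrier α i₀ d hsym hcanc hpure hsad H s hX hX1, hsumd s] at hx
    have hu := hH i₁ 0 s
    rw [htcCA_quadTerm_trigger α i₀ i₁ d hne hsym hcanc hpure hpar hsad hb H s hX hX1] at hu
    have hys := hy s
    rw [hsumg s] at hys
    have hfun : J = fun r => 1 - H i₀ 0 r ^ 2 - H i₁ 0 r ^ 2 - H i₀ 1 r ^ 2 := funext hJeq
    rw [hfun]
    have h := (((hasDerivAt_const s (1 : ℝ)).sub (hx.pow 2)).sub (hu.pow 2)).sub (hys.pow 2)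
    refine h.congr_deriv ?_
    push_cast
    ring
  -- J → 0 at -∞
  have hJlim : Tendsto J atBot (𝓝 0) := by
    have h : Tendsto J atBot (𝓝 (∑ j : Fin 4, (if j = i₀ ∨ j = i₁ then (0 : ℝ) else
        (if j = i₀ ∧ (0 : ℤ) = 0 then (1 : ℝ) else 0) ^ 2))) := by
      refine tendsto_finsetSum _ fun j _ => ?_
      by_cases hj : j = i₀ ∨ j = i₁
      · have hf : (fun s => if j = i₀ ∨ j = i₁ then (0 : ℝ) else H j 0 s ^ 2) = fun _ => 0 :=
          funext fun s => if_pos hj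
        rw [hf, if_pos hj]; exact tendsto_const_nhds
      · have hf : (fun s => if j = i₀ ∨ j = i₁ then (0 : ℝ) else H j 0 s ^ 2) = fun s => H j 0 s ^ 2 :=
          funext fun s => if_neg hj
        rw [hf, if_neg hj]; exact (hbot j 0).pow 2
    have hval : ∑ j : Fin 4, (if j = i₀ ∨ j = i₁ then (0 : ℝ) else
        (if j = i₀ ∧ (0 : ℤ) = 0 then (1 : ℝ) else 0) ^ 2) = 0 :=
      Finset.sum_eq_zero fun j _ => by
        by_cases hj : j = i₀ ∨ j = i₁
        · rw [if_pos hj]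
        · rw [if_neg hj, if_neg (fun h => hj (Or.inl h.1))]; ring
    rwa [hval] at h
  -- phase 1: while the carrier is nonnegative, J is nonincreasing, hence zero
  have h0b : Tendsto (H i₀ 0) atBot (𝓝 1) := by simpa using hbot i₀ 0
  obtain ⟨t₀, ht₀⟩ : ∃ t₀, ∀ s ≤ t₀, 0 ≤ H i₀ 0 s := by
    have hev : ∀ᶠ s in atBot, 0 ≤ H i₀ 0 s :=
      (h0b.eventually (Ioi_mem_nhds (show (0 : ℝ) < 1 by norm_num))).mono fun s hs => le_of_lt hs
    exact eventually_atBot.1 hev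
  have hdiffJ : Differentiable ℝ J := fun s => (hJ' s).differentiableAt
  have hanti : AntitoneOn J (Iic t₀) := by
    refine antitoneOn_of_deriv_nonpos (convex_Iic t₀) hdiffJ.continuous.continuousOn
      (hdiffJ.differentiableOn) fun s hs => ?_
    rw [interior_Iic] at hs
    rw [(hJ' s).deriv]
    have h1 : 2 * H i₀ 0 s * D s ≤ 0 := by
      have := ht₀ s (le_of_lt hs)
      nlinarith [hDnp s]
    have h2 : 0 ≤ 2 * H i₀ 1 s * G s := by
      nlinarith [(hy01 s).1, hGnn s]
    linarith
  have hphase1 : ∀ s, s ≤ t₀ → J s = 0 := by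
    intro s hs
    have hle : J s ≤ 0 :=
      ge_of_tendsto hJlim (eventually_atBot.2 ⟨s, fun r hr => hanti (show r ∈ Iic t₀ from hr.trans hs)
        (show s ∈ Iic t₀ from hs) hr⟩)
    exact le_antisymm hle (hJnn s)
  -- phase 2: Grönwall comparison J' ≤ C·J
  set V : ℝ → ℝ := fun s => J s * Real.exp (-(C * (s - t₀))) with hV
  have hV' : ∀ s, HasDerivAt V ((2 * H i₀ 0 s * D s - 2 * H i₀ 1 s * G s) * Real.exp (-(C * (s - t₀))) +
      J s * (Real.exp (-(C * (s - t₀))) * (-(C * 1)))) s := by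
    intro s
    have he : HasDerivAt (fun r => Real.exp (-(C * (r - t₀)))) (Real.exp (-(C * (s - t₀))) * (-(C * 1))) s :=
      (((hasDerivAt_id s).sub_const t₀).const_mul C).neg.exp
    exact (hJ' s).mul he
  have hVanti : Antitone V := by
    refine antitone_of_deriv_nonpos (fun s => (hV' s).differentiableAt) fun s => ?_
    rw [(hV' s).deriv]
    have hexp : 0 < Real.exp (-(C * (s - t₀))) := Real.exp_pos _
    have h1 : 2 * H i₀ 0 s * D s ≤ C * J s := by
      have ha : 2 * H i₀ 0 s * D s ≤ 2 * |H i₀ 0 s| * (-D s) := by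
        have : H i₀ 0 s * D s ≤ |H i₀ 0 s| * (-D s) := by
          have h3 : H i₀ 0 s * D s = -(H i₀ 0 s * (-D s)) := by ring
          rw [h3]
          have h4 : -(|H i₀ 0 s| * (-D s)) ≤ H i₀ 0 s * (-D s) := by
            have := neg_abs_le (H i₀ 0 s)
            nlinarith [hDnp s]
          linarith
        linarith
      have hb' : 2 * |H i₀ 0 s| * (-D s) ≤ 2 * 1 * (-D s) := by
        have := hxle s
        nlinarith [hDnp s, abs_nonneg (H i₀ 0 s)]
      have hc : 2 * 1 * (-D s) ≤ C * J s := by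
        rw [hC]; nlinarith [hDbd s]
      linarith
    have h2 : 0 ≤ 2 * H i₀ 1 s * G s := by nlinarith [(hy01 s).1, hGnn s]
    nlinarith
  have hphase2 : ∀ s, t₀ ≤ s → J s = 0 := by
    intro s hs
    have h := hVanti hs
    simp only [hV, sub_self, mul_zero, neg_zero, Real.exp_zero, mul_one, hphase1 t₀ le_rfl] at h
    have hexp : 0 < Real.exp (-(C * (s - t₀))) := Real.exp_pos _
    have hle : J s ≤ 0 := by
      by_contra hcon
      push Not at hcon
      have := mul_pos hcon hexp
      linarith
    exact le_antisymm hle (hJnn s)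
  -- conclusion
  intro j t hj0 hj1
  have hJt : J t = 0 := by
    rcases le_total t t₀ with h | h
    · exact hphase1 t h
    · exact hphase2 t h
  have h := hterm_le t j hj0 hj1
  rw [hJt] at h
  exact pow_eq_zero_iff (n := 2) (by norm_num) |>.1 (le_antisymm h (sq_nonneg _))

end Summit.NavierStokesRegularity.NavierStokesRegularity.Theorems

end
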